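import Literature.AlgebraicGeometry.HilbertScheme.TransferOperatorSuperCommutators
import Literature.AlgebraicGeometry.Hyperkaehler.TotalCohomologyLefschetzModule
import HarnessLib

/-!
# The Lefschetz dual of a divisor class `D_α` on `S^[n]` is the transfer `T(Λ_S)|ₙ` of the surface's dual
Lefschetz operator — PROVED for every smooth projective surface (odd cohomology allowed)

Layer `Literature/AlgebraicGeometry/HilbertScheme`; theorem-only sequel of `TransferOperatorSuperCommutators`
(no definitions, no named facts).  G. Oberdieck, *A Lie algebra action on the Chow ring of the Hilbert scheme of
points of a K3 surface*, Comment. Math. Helv. 96 (2021): Thm. 3.1 (b) "`h = 2Σ_{n>0} n⁻¹ 𝔮ₙ𝔮₋ₙ(c₂ − c₁)` acts on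
`A^i(S^[n])` by multiplication by `i − n`" (cohomological degree `j = 2i`: by `j − 2n`), Rmk. 3.2 "for any
`α ∈ H²(S, ℚ)` … `(α, α) ≠ 0` … `e_α` admits the Lefschetz dual `f̃_α/(α·α)`" (valid for `b₁(S) = 0`, see the scope
caveat of `LefschetzDualTransfer`), and §3.2 "Applying `T` to these correspondences precisely yields the operators
`(e_α)`, `(h)`, `(f̃_α)`", "`h` acts on `Hʲ(S^[n])` by multiplication by `j − 2n`", Cor. 3.5 `[T_Γ, T_Γ̃] = T_{[Γ,Γ̃]}`.

In the rendering of the prequels (Nakajima operators `𝔮` of an instance `𝔊 : ChernCharacterOperators hS H` acting on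
`ℍ = ⨁ₙ H*(S^[n](ℂ); ℂ)` on the real carriers, `transferOp 𝔊.q C t φ` for an endomorphism `φ` of `H*(S(ℂ); ℂ)` of
degree `2t` and an EVEN Casimir tensor `C` of the Poincaré pairing), this file proves, for EVERY smooth projective
surface `S` (the super-relations of LQW (2.7) are handled in the prequel):

* `NakajimaOperators.transferOp_degreeOperator`: **`T(h_S) = ⨁ₙ h_{S^[n]}`** — the transfer (`t = 0`) of the degree
  operator `h_S` of the surface (`i − 2` on `Hⁱ(S)`) is the operator acting on `Hʲ(S^[n])` by `j − 2n` (both kill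
  the vacuum and have commutator `𝔮ₘ((i − 2)a)` with `𝔮ₘ(a)`, `a ∈ Hⁱ(S)` — Oberdieck's "`[h, 𝔮ₙ(u)] = (i−2)𝔮ₙ(u)`"
  — by the bi-degree axiom; cyclicity); `restrictFock_transferOp_degreeOperator`: `T(h_S)|ₙ = h_{S^[n]}`;
* `ChernCharacterOperators.totalLefschetz_divisorClass`: `∪D_α = T(L_α)|ₙ` on `H*(S^[n])` (Lehn's formula, prequel);
* **`ChernCharacterOperators.isDualLefschetz_transferOp`** (D3 of the `hodge-kum4` lane-V brief): for `α ∈ H²(S)`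
  with a dual Lefschetz operator `Λ_S` ON THE SURFACE (`(L_α, h_S, Λ_S)` an `𝔰𝔩₂`-triple on `H*(S(ℂ); ℂ)`) and `n`
  with `h_{S^[n]} ≠ 0` (every `n ≥ 1`): **`(∪D_α, h_{S^[n]}, T(Λ_S)|ₙ)` is an `𝔰𝔩₂`-triple on `H*(S^[n](ℂ); ℂ)`**,
  `IsDualLefschetz (2n) (D_α) (T(Λ_S)|ₙ)` — from `[T(L_α), T(Λ_S)] = T([L_α, Λ_S]) = T(h_S)` and
  `[T(h_S), T(Λ_S)] = T([h_S, Λ_S]) = −2T(Λ_S)` (Cor. 3.5, super-version) restricted to the summand `ℍₙ`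
  (`restrictFock_mul`: transfer operators preserve every `ℍₙ`, `IsHeisenbergRepresentation.transferOp_apply_ofSummand_mem_range`).
  For `b₁(S) = 0`, `T(Λ_S) = f̃_α/(α,α)` and this is Oberdieck's Thm. 3.1 (b) / Rmk. 3.2 in cohomology; for an
  abelian surface `Λ_S` has an `H³ → H¹` component (Oberdieck's correspondence `2(α₁ + α₂)/(α,α)` completed by its odd
  Künneth part), and the statement is the one the lane-V engine implements.

Also: `IsDualLefschetz.isOfDegree` (a dual Lefschetz operator has degree `−2`, via the eigenspaces of `h`,
`Hyperkaehler.degreeSpace_degreeOperator_eq_range`), `isOfDegree_degreeOperator`, the block lemmas `restrictFock_apply`,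
`ofSummand_restrictFock_apply`, `restrictFock_mul`.

Hypotheses kept explicit (not derived here): `C` even (the Künneth class of the diagonal is; every Casimir element is,
by Poincaré duality — not needed); `h_{S^[n]} ≠ 0` (holds for `n ≥ 1` since `1 ∈ H⁰(S^[n]) ≠ 0`,
`Hyperkaehler.degreeOperator_ne_zero_of_ne_zero`; at `n = 0` the statement is false, `h_{S^[0]} = 0`).
-/

noncomputable section

open DirectSum TensorProduct
open Literature.AlgebraicTopology.SingularHomology
open Literature.AlgebraicGeometry.Motives (SchemeOver ComplexPoints IsSmoothProjective)
open Literature.AlgebraicGeometry.Hyperkaehler (totalCohomology ofDegree totalCup totalLefschetz degreeOperator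
  IsDualLefschetz isDualLefschetz_iff totalLefschetz_eq_totalCup degreeOperator_lof degreeSpace_degreeOperator_eq_range
  degreeSpace_degreeOperator_eq_bot)
open Literature.AlgebraicGeometry.HodgeTheory (complexBetti)
open Literature.Algebra.Lie (degreeSpace mem_degreeSpace_iff)

namespace Literature.AlgebraicGeometry.HilbertScheme

/-! ### Blocks of operators preserving the summands `ℍₚ` -/

section Blocks

universe u v w

variable {K : Type u} [Field K]
variable {A : ℕ → Type v} [∀ i, AddCommGroup (A i)] [∀ i, Module K (A i)]
variable {Φ : ℕ → ℕ → Type w} [∀ n i, AddCommGroup (Φ n i)] [∀ n i, Module K (Φ n i)]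

/-- Unfolding of the block `T|_{ℍₚ}`. [cite: LiQinWang2002, Thm. 1.2 p. 2] -/
theorem restrictFock_apply (T : Module.End K (Fock Φ)) (p : ℕ) (y : FockSummand Φ p) :
    restrictFock K Φ T p y = DirectSum.component K ℕ (fun n ↦ FockSummand Φ n) p (T (Fock.ofSummand K Φ p y)) :=
  rfl

/-- If `T` maps `ℍₚ` into `ℍₚ`, then `T|_{ℍₚ}` followed by the inclusion is `T` on `ℍₚ`.
[cite: LiQinWang2002, Thm. 1.2 p. 2] -/
theorem ofSummand_restrictFock_apply {T : Module.End K (Fock Φ)} {p : ℕ} {y : FockSummand Φ p}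
    (hT : T (Fock.ofSummand K Φ p y) ∈ LinearMap.range (Fock.ofSummand K Φ p)) :
    Fock.ofSummand K Φ p (restrictFock K Φ T p y) = T (Fock.ofSummand K Φ p y) := by
  obtain ⟨z, hz⟩ := hT
  rw [restrictFock_apply, ← hz]
  erw [DirectSum.component.lof_self]

/-- Blocks are multiplicative against operators preserving the summand. [cite: LiQinWang2002, Thm. 1.2 p. 2] -/
theorem restrictFock_mul {X Y : Module.End K (Fock Φ)} {p : ℕ}
    (hY : ∀ y : FockSummand Φ p, Y (Fock.ofSummand K Φ p y) ∈ LinearMap.range (Fock.ofSummand K Φ p)) :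
    restrictFock K Φ (X * Y) p = restrictFock K Φ X p * restrictFock K Φ Y p := by
  refine LinearMap.ext fun y ↦ ?_
  rw [Module.End.mul_apply, restrictFock_apply, restrictFock_apply X, Module.End.mul_apply,
    ofSummand_restrictFock_apply (hY y)]

namespace IsHeisenbergRepresentation

variable {B : (⨁ i, A i) →ₗ[K] (⨁ i, A i) →ₗ[K] K} {q : ℤ → (⨁ i, A i) →ₗ[K] Module.End K (Fock Φ)}
  {vac : Fock Φ}

/-- A transfer term `Σᵢ 𝔮ₙ(φεᵢ)𝔮₋ₙ(eᵢ)`, `n > 0`, maps `ℍₚ` into `ℍₚ`. [cite: Oberdieck2021, §3.2 p. 7] -/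
theorem transferTerm_apply_ofSummand_mem_range (h : IsHeisenbergRepresentation B q vac)
    (C : (⨁ i, A i) ⊗[K] (⨁ i, A i)) (φ : (⨁ i, A i) →ₗ[K] (⨁ i, A i)) {n : ℤ} (hn : 0 < n) (p : ℕ)
    (y : FockSummand Φ p) :
    transferTerm K q C φ n (Fock.ofSummand K Φ p y) ∈ LinearMap.range (Fock.ofSummand K Φ p) := by
  induction C using TensorProduct.induction_on with
  | zero => simp [transferTerm]
  | tmul e ε =>
    rw [transferTerm_tmul, Module.End.mul_apply]
    obtain ⟨n', rfl⟩ := Int.eq_ofNat_of_zero_le hn.le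
    by_cases hp : n' ≤ p
    · obtain ⟨z, hz⟩ :=
        h.apply_ofSummand_mem_range (-(n' : ℤ)) e (p := p) (p' := p - n') (by push_cast [hp]; ring) y
      rw [← hz]
      exact h.apply_ofSummand_mem_range (n' : ℤ) (φ ε) (by push_cast [hp]; ring) z
    · rw [h.apply_ofSummand_eq_zero (-(n' : ℤ)) e (by omega) y, map_zero]
      exact Submodule.zero_mem _
  | add x x' hx hx' =>
    simp only [transferTerm, map_add, LinearMap.add_apply] at hx hx' ⊢
    exact Submodule.add_mem _ hx hx'

/-- **A transfer operator maps every `ℍₚ` into itself** (bi-degree `(0, ·)`). [cite: Oberdieck2021, §3.2 p. 7] -/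
theorem transferOp_apply_ofSummand_mem_range (h : IsHeisenbergRepresentation B q vac)
    (C : (⨁ i, A i) ⊗[K] (⨁ i, A i)) (t : ℤ) (φ : (⨁ i, A i) →ₗ[K] (⨁ i, A i)) (p : ℕ) (y : FockSummand Φ p) :
    transferOp K q C t φ (Fock.ofSummand K Φ p y) ∈ LinearMap.range (Fock.ofSummand K Φ p) := by
  rw [transferOp_apply_ofSummand]
  refine Submodule.neg_mem _ (Submodule.sum_mem _ fun n hn ↦ Submodule.smul_mem _ _ ?_)
  have hn1 : (0 : ℤ) < n := by
    simp only [Finset.mem_Icc] at hn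
    exact_mod_cast hn.1
  exact h.transferTerm_apply_ofSummand_mem_range C φ hn1 p y

end IsHeisenbergRepresentation

end Blocks

/-! ### `T(h_S)|ₙ = h_{S^[n]}` and the `𝔰𝔩₂`-triple `(∪D_α, h, T(Λ_S)|ₙ)` on `H*(S^[n])` -/

section Geometric

variable {S : SchemeOver ℂ} {hS : IsSmoothProjective 2 S} {H : HilbertSchemesOfPoints S}

/-- **A dual Lefschetz operator has degree `−2`**: `⁅h, Λ⁆ = −2Λ` makes `Λx`, `x ∈ Hᵏ`, an eigenvector of `h`
for `k − 2 − N`, i.e. an element of `H^{k−2}` (characteristic zero). [cite: LooijengaLunts1997, §1 (1.1) p. 4] -/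
theorem _root_.Literature.AlgebraicGeometry.Hyperkaehler.IsDualLefschetz.isOfDegree {Y : Type} [TopologicalSpace Y]
    {N : ℕ} {a : singularCohomology ℂ ℂ Y 2} {Λ : Module.End ℂ (totalCohomology ℂ Y)} (hΛ : IsDualLefschetz N a Λ) :
    IsOfDegree ℂ Y Λ (2 * (-1)) := by
  obtain ⟨-, -, hhf⟩ := (isDualLefschetz_iff N a Λ).mp hΛ
  have hhf' : ∀ v, degreeOperator ℂ Y N (Λ v) - Λ (degreeOperator ℂ Y N v) = -(Λ v + Λ v) := fun v ↦ by
    have h1 := LinearMap.congr_fun hhf v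
    rw [Ring.lie_def, LinearMap.sub_apply, Module.End.mul_apply, Module.End.mul_apply, two_nsmul,
      LinearMap.neg_apply, LinearMap.add_apply] at h1
    exact h1
  intro k x
  have hmem : Λ (ofDegree ℂ Y k x) ∈ degreeSpace (degreeOperator ℂ Y N) ((k : ℤ) - 2 - N) := by
    rw [mem_degreeSpace_iff]
    have h1 := hhf' (ofDegree ℂ Y k x)
    rw [degreeOperator_lof, map_smul, sub_eq_iff_eq_add] at h1
    rw [h1]
    push_cast
    module
  by_cases hk : 0 ≤ (k : ℤ) + 2 * (-1)
  · obtain ⟨k', hk'⟩ : ∃ k' : ℕ, k = k' + 2 := ⟨k - 2, by omega⟩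
    subst hk'
    rw [shiftedPart, if_pos hk, show (((k' + 2 : ℕ) : ℤ) + 2 * (-1)).toNat = k' by omega,
      ← degreeSpace_degreeOperator_eq_range N k' (m := ((k' + 2 : ℕ) : ℤ) - 2 - N) (by push_cast; ring)]
    exact hmem
  · rw [shiftedPart, if_neg hk]
    rw [degreeSpace_degreeOperator_eq_bot N (by omega)] at hmem
    exact hmem

/-- The degree operator has degree `0`. [cite: LooijengaLunts1997, §1 p. 3] -/
theorem isOfDegree_degreeOperator {Y : Type} [TopologicalSpace Y] (N : ℕ) :
    IsOfDegree ℂ Y (degreeOperator ℂ Y N) (2 * 0) := by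
  intro k x
  rw [mul_zero, show (0 : ℤ) = ((0 : ℕ) : ℤ) from rfl, shiftedPart_natCast, degreeOperator_lof, add_zero]
  exact Submodule.smul_mem _ _ (LinearMap.mem_range_self _ _)

/-- The summand-wise degree operator `⨁ₙ h_{S^[n]}` on `ℍ` multiplies `ℍ^{n,k}` by `k − 2n`.
[cite: Oberdieck2021, §3.2 p. 7 ("h acts on Hʲ(S^[n]) by multiplication by j − 2n")] -/
theorem fiberwise_degreeOperator_of (n k : ℕ) (z : fockFamily H n k) :
    fiberwise ℂ (fockFamily H) (fun p ↦ degreeOperator ℂ (ComplexPoints (H.obj p)) (2 * p))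
        (Fock.of ℂ (fockFamily H) n k z) =
      ((k : ℂ) - (2 * n : ℕ)) • Fock.of ℂ (fockFamily H) n k z := by
  rw [show Fock.of ℂ (fockFamily H) n k z = Fock.ofSummand ℂ (fockFamily H) n (lof ℂ ℕ (fockFamily H n) k z)
      from rfl, fiberwise_apply_ofSummand, ← map_smul]
  congr 1
  exact degreeOperator_lof (2 * n) k z

/-- **`T(h_S) = ⨁ₙ h_{S^[n]}` on `ℍ`**: the transfer (`t = 0`) of the degree operator `h_S` of the surface (`i − 2`
on `Hⁱ(S)`) is the summand-wise degree operator (`j − 2n` on `Hʲ(S^[n])`), for every surface, every instance of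
Nakajima's operators and every even Casimir tensor — Oberdieck §3.2: "`[h, 𝔮ₙ(u)] = (i−2)𝔮ₙ(u)` … `h` acts on
`Hʲ(S^[n])` by multiplication by `j − 2n`" (his `h = T_{2(c₂−c₁)}` for `H^odd = 0`; here `h_S` is the degree
operator itself, so odd classes are allowed). [cite: Oberdieck2021, §3.2 p. 7] -/
theorem NakajimaOperators.transferOp_degreeOperator (𝔑 : NakajimaOperators hS H)
    {C : totalCohomology ℂ (ComplexPoints S) ⊗[ℂ] totalCohomology ℂ (ComplexPoints S)}
    (hCg : C ∈ evenTensorSpan ℂ (coeffFamily S)) (hC : IsCasimir ℂ (poincarePairing hS) C) :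
    transferOp ℂ 𝔑.q C 0 (degreeOperator ℂ (ComplexPoints S) 2) =
      fiberwise ℂ (fockFamily H) (fun n ↦ degreeOperator ℂ (ComplexPoints (H.obj n)) (2 * n)) := by
  refine 𝔑.ext_of_commute ?_ ?_
  · rw [transferOp_vac 𝔑.isHeisenberg, vacuumVector_eq_unitVector, unitVector, fiberwise_degreeOperator_of]
    simp
  · intro m hm v
    rw [𝔑.transferOp_commute_super hCg hC 0 (isOfDegree_degreeOperator 2) hm v, zpow_zero, one_smul]
    obtain ⟨m', rfl⟩ := Int.eq_ofNat_of_zero_le hm.le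
    have hm' : 1 ≤ m' := by exact_mod_cast hm
    -- both sides are linear in `v` and in the vector; reduce to homogeneous `v = a ∈ Hⁱ(S)` and `x ∈ ℍ^{n,k}`
    refine (LinearMap.ext fun x ↦ ?_).symm
    rw [LinearMap.sub_apply, Module.End.mul_apply, Module.End.mul_apply]
    induction v using DirectSum.induction_on with
    | zero => simp only [map_zero, LinearMap.zero_apply, sub_self]
    | add v w hv hw =>
      simp only [map_add, LinearMap.add_apply] at hv hw ⊢
      rw [← hv, ← hw]
      abel
    | of i a =>
    rw [← DirectSum.lof_eq_of ℂ]
    induction x using DirectSum.induction_on with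
    | zero => simp only [map_zero, sub_self]
    | add x x' hx hx' =>
      simp only [map_add]
      rw [← hx, ← hx']
      abel
    | of n y =>
    induction y using DirectSum.induction_on with
    | zero => simp only [map_zero, sub_self]
    | add y y' hy hy' =>
      simp only [map_add]
      rw [← hy, ← hy']
      abel
    | of k z =>
    rw [← DirectSum.lof_eq_of ℂ, ← DirectSum.lof_eq_of ℂ,
      show lof ℂ ℕ (fun n ↦ FockSummand (fockFamily H) n) n (lof ℂ ℕ (fun i ↦ fockFamily H n i) k z) =
        Fock.of ℂ (fockFamily H) n k z from rfl]
    -- `𝔮ₘ(a) x ∈ ℍ^{n+m, k+2m−2+i}`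
    have hmem := 𝔑.isHeisenberg.bidegree (m' : ℤ) i a n k z
    have hd : ((k : ℤ) + 2 * (m' : ℤ) - 2 + i) = ((k + i + 2 * m' - 2 : ℕ) : ℤ) := by omega
    rw [show ((n : ℤ) + (m' : ℤ)) = ((n + m' : ℕ) : ℤ) by push_cast; ring, hd, bidegPart_natCast] at hmem
    obtain ⟨w, hw⟩ := hmem
    have hw' : 𝔑.q (m' : ℤ) (lof ℂ ℕ (coeffFamily S) i a) (Fock.of ℂ (fockFamily H) n k z) =
        Fock.of ℂ (fockFamily H) (n + m') (k + i + 2 * m' - 2) w := hw.symm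
    rw [hw', fiberwise_degreeOperator_of, ← hw', fiberwise_degreeOperator_of, map_smul, ← sub_smul,
      show degreeOperator ℂ (ComplexPoints S) 2 (lof ℂ ℕ (coeffFamily S) i a) =
        ((i : ℂ) - (2 : ℕ)) • lof ℂ ℕ (coeffFamily S) i a from degreeOperator_lof 2 i a,
      map_smul, LinearMap.smul_apply]
    congr 1
    rw [Nat.cast_sub (by omega)]
    push_cast
    ring

/-- **`T(h_S)|ₙ = h_{S^[n]}`.** [cite: Oberdieck2021, §3.2 p. 7] -/
theorem NakajimaOperators.restrictFock_transferOp_degreeOperator (𝔑 : NakajimaOperators hS H)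
    {C : totalCohomology ℂ (ComplexPoints S) ⊗[ℂ] totalCohomology ℂ (ComplexPoints S)}
    (hCg : C ∈ evenTensorSpan ℂ (coeffFamily S)) (hC : IsCasimir ℂ (poincarePairing hS) C) (n : ℕ) :
    restrictFock ℂ (fockFamily H) (transferOp ℂ 𝔑.q C 0 (degreeOperator ℂ (ComplexPoints S) 2)) n =
      degreeOperator ℂ (ComplexPoints (H.obj n)) (2 * n) := by
  rw [𝔑.transferOp_degreeOperator hCg hC, restrictFock_fiberwise]

/-- Cup product with the divisor class `D_α = G₀(α, n)` on `H*(S^[n])` is the block of `T(L_α)`.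
[cite: Oberdieck2021, §3.1 (3.1) p. 6] [cite: LiQinWang2002, Thm. 5.13 (iv)] -/
theorem ChernCharacterOperators.totalLefschetz_divisorClass (𝔊 : ChernCharacterOperators hS H)
    {C : totalCohomology ℂ (ComplexPoints S) ⊗[ℂ] totalCohomology ℂ (ComplexPoints S)}
    (hCg : C ∈ evenTensorSpan ℂ (coeffFamily S)) (hC : IsCasimir ℂ (poincarePairing hS) C) (n : ℕ)
    (α : complexBetti S 2) :
    totalLefschetz (𝔊.divisorClass n α) =
      restrictFock ℂ (fockFamily H) (transferOp ℂ 𝔊.q C 1 (totalLefschetz α)) n := by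
  rw [← 𝔊.cupOperator_zero_eq_transferOp_super hCg hC α, ChernCharacterOperators.cupOperator, restrictFock_fiberwise,
    totalLefschetz_eq_totalCup, 𝔊.ofDegree_divisorClass]

/-- **D3 — the Lefschetz dual of `D_α` on `S^[n]` is `T(Λ_S)|ₙ` (every smooth projective surface).**  For an
instance `𝔊` of the Chern character operators, an even Casimir tensor `C` of the Poincaré pairing, a class
`α ∈ H²(S(ℂ); ℂ)` with a dual Lefschetz operator `Λ_S` ON THE SURFACE (`(L_α, h_S, Λ_S)` an `𝔰𝔩₂`-triple on
`H*(S)`), and `n` with `h_{S^[n]} ≠ 0` (i.e. `n ≥ 1`): `(∪D_α, h_{S^[n]}, T(Λ_S)|ₙ)` is an `𝔰𝔩₂`-triple on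
`H*(S^[n](ℂ); ℂ)` — `T(L_α)|ₙ = ∪D_α` (Lehn), `T(h_S)|ₙ = h_{S^[n]}`, and `[T φ, T ψ] = T[φ, ψ]` (Oberdieck Cor. 3.5,
super-version).  For `b₁(S) = 0` this is Oberdieck's Thm. 3.1 (b) / Rmk. 3.2 (`T(Λ_S) = f̃_α/(α,α)`); for an abelian
surface `Λ_S` has an `H³ → H¹` component.  [cite: Oberdieck2021, Thm. 3.1 (b), Rmk. 3.2 and §3.2 (pp. 6–7)]
[cite: LooijengaLunts1997, §1 p. 4] -/
theorem ChernCharacterOperators.isDualLefschetz_transferOp (𝔊 : ChernCharacterOperators hS H)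
    {C : totalCohomology ℂ (ComplexPoints S) ⊗[ℂ] totalCohomology ℂ (ComplexPoints S)}
    (hCg : C ∈ evenTensorSpan ℂ (coeffFamily S)) (hC : IsCasimir ℂ (poincarePairing hS) C) {α : complexBetti S 2}
    {Λ : Module.End ℂ (totalCohomology ℂ (ComplexPoints S))} (hΛ : IsDualLefschetz 2 α Λ) {n : ℕ}
    (hh : degreeOperator ℂ (ComplexPoints (H.obj n)) (2 * n) ≠ 0) :
    IsDualLefschetz (2 * n) (𝔊.divisorClass n α) (restrictFock ℂ (fockFamily H) (transferOp ℂ 𝔊.q C (-1) Λ) n) := by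
  obtain ⟨-, hef₀, hhf₀⟩ := (isDualLefschetz_iff 2 α Λ).mp hΛ
  have hef₁ : totalLefschetz α * Λ - Λ * totalLefschetz α = degreeOperator ℂ (ComplexPoints S) 2 :=
    (Ring.lie_def _ _).symm.trans hef₀
  have hhf₁ : degreeOperator ℂ (ComplexPoints S) 2 * Λ - Λ * degreeOperator ℂ (ComplexPoints S) 2 = -(Λ + Λ) :=
    ((Ring.lie_def _ _).symm.trans hhf₀).trans (by rw [two_nsmul])
  have hLdeg : IsOfDegree ℂ (ComplexPoints S) (totalLefschetz α) (2 * 1) := by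
    simpa using isOfDegree_totalLefschetz (R := ℂ) α
  have hΛdeg : IsOfDegree ℂ (ComplexPoints S) Λ (2 * (-1)) := IsDualLefschetz.isOfDegree hΛ
  set TL := transferOp ℂ 𝔊.q C 1 (totalLefschetz α) with hTL
  set TΛ := transferOp ℂ 𝔊.q C (-1) Λ with hTΛ
  set Th := transferOp ℂ 𝔊.q C 0 (degreeOperator ℂ (ComplexPoints S) 2) with hTh
  -- Cor. 3.5 (super-version) on `ℍ`: `[T(L_α), T(Λ)] = T(h_S)` and `[T(h_S), T(Λ)] = −2 T(Λ)`
  have hef : TL * TΛ - TΛ * TL = Th := by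
    rw [hTL, hTΛ, hTh, 𝔊.toNakajimaOperators.transferOp_lie_super hCg hC 1 (-1) hLdeg hΛdeg, add_neg_cancel, hef₁]
  have hhf : Th * TΛ - TΛ * Th = -(TΛ + TΛ) := by
    rw [hTΛ, hTh, 𝔊.toNakajimaOperators.transferOp_lie_super hCg hC 0 (-1) (isOfDegree_degreeOperator 2) hΛdeg,
      zero_add, hhf₁, show -(Λ + Λ) = (-1 : ℂ) • (Λ + Λ) from (neg_one_smul ℂ (Λ + Λ)).symm, transferOp_smul,
      transferOp_add]
    exact neg_one_smul ℂ (transferOp ℂ 𝔊.q C (-1) Λ + transferOp ℂ 𝔊.q C (-1) Λ)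
  -- the blocks on `ℍₙ = H*(S^[n])`
  have hΛn : ∀ y, TΛ (Fock.ofSummand ℂ (fockFamily H) n y) ∈ LinearMap.range (Fock.ofSummand ℂ (fockFamily H) n) :=
    𝔊.isHeisenberg.transferOp_apply_ofSummand_mem_range C (-1) Λ n
  have hLn : ∀ y, TL (Fock.ofSummand ℂ (fockFamily H) n y) ∈ LinearMap.range (Fock.ofSummand ℂ (fockFamily H) n) :=
    𝔊.isHeisenberg.transferOp_apply_ofSummand_mem_range C 1 (totalLefschetz α) n
  have hhn : ∀ y, Th (Fock.ofSummand ℂ (fockFamily H) n y) ∈ LinearMap.range (Fock.ofSummand ℂ (fockFamily H) n) :=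
    𝔊.isHeisenberg.transferOp_apply_ofSummand_mem_range C 0 _ n
  have hThn : restrictFock ℂ (fockFamily H) Th n = degreeOperator ℂ (ComplexPoints (H.obj n)) (2 * n) :=
    𝔊.toNakajimaOperators.restrictFock_transferOp_degreeOperator hCg hC n
  have hTLn : totalLefschetz (𝔊.divisorClass n α) = restrictFock ℂ (fockFamily H) TL n :=
    𝔊.totalLefschetz_divisorClass hCg hC n α
  refine (isDualLefschetz_iff _ _ _).mpr ⟨hh, ?_, ?_⟩
  · -- `⁅∪D_α, T(Λ)|ₙ⁆ = h_{S^[n]}`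
    rw [Ring.lie_def, hTLn, ← restrictFock_mul hΛn, ← restrictFock_mul hLn, ← hThn, ← hef]
    refine LinearMap.ext fun y ↦ ?_
    rw [LinearMap.sub_apply, restrictFock_apply, restrictFock_apply, restrictFock_apply, LinearMap.sub_apply,
      map_sub]
  · -- `⁅h_{S^[n]}, T(Λ)|ₙ⁆ = −2 T(Λ)|ₙ`
    rw [Ring.lie_def, ← hThn, ← restrictFock_mul hΛn, ← restrictFock_mul hhn, two_nsmul]
    refine LinearMap.ext fun y ↦ ?_
    rw [LinearMap.sub_apply, restrictFock_apply, restrictFock_apply, LinearMap.neg_apply, LinearMap.add_apply,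
      restrictFock_apply, ← map_sub, ← LinearMap.sub_apply, hhf, LinearMap.neg_apply, map_neg, LinearMap.add_apply,
      map_add]

end Geometric

end Literature.AlgebraicGeometry.HilbertScheme

end
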